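import Literature.MathematicalPhysics.QuantumLattice.HubbardPairEnergy
import Literature.MathematicalPhysics.QuantumLattice.HubbardFermiPolar
import HarnessLib

/-!
# The pair energy along the band Fermi curve is second-order nondegenerate in three directions

Topic `Literature/MathematicalPhysics/QuantumLattice`; continues `HubbardPairEnergy` (the pair
energy `G(θ, φ) = ε(p + γ_μ(θ) + γ_μ(φ)) - μ`, its slice derivatives `pairE₁ = ∂_θG`, `pairE₂ = ∂_φG`,
`pairE₁₁`, `pairE₂₂`, and the diagonal second derivative `pairEdd`) and `HubbardFermiBandCurvature`
(strict convexity `bandHess_pos`, and the Gauss-map injectivity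
`exists_eq_add_int_mul_pi_of_cross_eq_zero`).

**Theorem** (`pairE_nondegenerate`). For `-4 < μ < 0` and all `p, θ, φ`, the six numbers
`G, ∂_θG, ∂_φG, ∂²_θG, ∂²_φG, (∂_θ+∂_φ)²G` at `(θ, φ)` are not all zero.

*Proof.* If `G = 0` the pair momentum `P = p + γ(θ) + γ(φ)` lies on the level curve, so
`(cos Pᵢ, sin Pᵢ) = (cos, sin)` of `γ(ψ)` for some `ψ` (`exists_angle_of_level`). `∂_θG = 0` says
`∇ε(P) ⊥ γ'(θ)`; with `∇ε(γ(θ)) ⊥ γ'(θ)` the two gradients are parallel, so `θ = ψ + jπ`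
(Gauss map), and likewise `φ = ψ + j'π`; by the central symmetry the frame
`(x, y, x', y', x'', y'')` at `ψ + jπ` is `±` that at `ψ`. With `Q = cos x·x'² + cos y·y'² > 0` and
`sin x·x'' + sin y·y'' = -Q` at `ψ` one finds `∂²_θG = 2Q(1 ∓ 1)`, `∂²_φG = 2Q(1 ∓ 1)`,
`∂_θ∂_φG = ±2Q`; the vanishing of the pure second derivatives forces both signs `+`, and then
`(∂_θ+∂_φ)²G = 4Q ≠ 0`.

Everything is proved; no definitions. [folklore]
-/

noncomputable section

open Real Set Filter
open scoped Topology

namespace Literature.MathematicalPhysics.QuantumLattice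

section Band

variable {μ : ℝ} (hμ₁ : -4 < μ) (hμ₂ : μ < 0)
include hμ₁ hμ₂

/-! ### Points of the level set are points of the curve, up to the lattice -/

/-- **A point `(X, Y)` with `cos X + cos Y = -μ/2` has the cosines and sines of a point of the
level-`μ` curve**: `∃ ψ`, `(cos X, sin X, cos Y, sin Y) = (cos x(ψ), sin x(ψ), cos y(ψ), sin y(ψ))`
(reduce modulo `2π` into `(-π, π]²` and use the polar parametrisation of the level set). [folklore] -/
theorem exists_angle_of_level {X Y : ℝ} (h : Real.cos X + Real.cos Y = -μ / 2) :
    ∃ ψ : ℝ, Real.cos (bandX μ ψ) = Real.cos X ∧ Real.sin (bandX μ ψ) = Real.sin X ∧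
      Real.cos (bandY μ ψ) = Real.cos Y ∧ Real.sin (bandY μ ψ) = Real.sin Y := by
  -- reduce modulo `2π`
  set X' : ℝ := toIocMod Real.two_pi_pos (-π) X with hX'
  set Y' : ℝ := toIocMod Real.two_pi_pos (-π) Y with hY'
  have hXm : X' ∈ Ioc (-π) (-π + 2 * π) := toIocMod_mem_Ioc Real.two_pi_pos (-π) X
  have hYm : Y' ∈ Ioc (-π) (-π + 2 * π) := toIocMod_mem_Ioc Real.two_pi_pos (-π) Y
  have hXe : ∃ m : ℤ, X' = X + m * (2 * π) :=
    ⟨-toIocDiv Real.two_pi_pos (-π) X, by rw [hX', toIocMod, zsmul_eq_mul]; push_cast; ring⟩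
  have hYe : ∃ n : ℤ, Y' = Y + n * (2 * π) :=
    ⟨-toIocDiv Real.two_pi_pos (-π) Y, by rw [hY', toIocMod, zsmul_eq_mul]; push_cast; ring⟩
  obtain ⟨m, hm⟩ := hXe
  obtain ⟨n, hn⟩ := hYe
  have hcX : Real.cos X' = Real.cos X := by rw [hm, Real.cos_add_int_mul_two_pi]
  have hsX : Real.sin X' = Real.sin X := by rw [hm, Real.sin_add_int_mul_two_pi]
  have hcY : Real.cos Y' = Real.cos Y := by rw [hn, Real.cos_add_int_mul_two_pi]
  have hsY : Real.sin Y' = Real.sin Y := by rw [hn, Real.sin_add_int_mul_two_pi]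
  -- the reduced point is on the level set inside the closed square
  set k : EuclideanSpace ℝ (Fin 2) := WithLp.toLp 2 ![X', Y'] with hk
  have hnorm : ‖WithLp.ofLp k‖ ≤ π := by
    rw [hk, WithLp.ofLp_toLp, pi_norm_le_iff_of_nonneg Real.pi_pos.le]
    intro i
    fin_cases i
    · simpa [Real.norm_eq_abs, abs_le] using And.intro hXm.1.le (by linarith [hXm.2])
    · simpa [Real.norm_eq_abs, abs_le] using And.intro hYm.1.le (by linarith [hYm.2])
  have hlevel : sqDispersion (WithLp.ofLp k) = μ := by
    simp only [hk, WithLp.ofLp_toLp, sqDispersion, Matrix.cons_val_zero, Matrix.cons_val_one,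
      Matrix.cons_val_fin_one, hcX, hcY]
    linarith
  obtain ⟨ψ, -, hψ⟩ := exists_fermiPolar_eq hμ₁ hμ₂ hnorm hlevel
  have h0 : bandX μ ψ = X' := by
    have h := congrArg (fun v : EuclideanSpace ℝ (Fin 2) => v 0) hψ
    simpa [hk, bandX] using h
  have h1 : bandY μ ψ = Y' := by
    have h := congrArg (fun v : EuclideanSpace ℝ (Fin 2) => v 1) hψ
    simpa [hk, bandY] using h
  exact ⟨ψ, by rw [h0, hcX], by rw [h0, hsX], by rw [h1, hcY], by rw [h1, hsY]⟩

/-! ### The frame under the half-turn `θ ↦ θ + jπ` -/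

/-- `u''(θ + π) = u''(θ)`. [folklore] -/
theorem bandRadiusDeriv2_add_pi (θ : ℝ) : bandRadiusDeriv2 μ (θ + π) = bandRadiusDeriv2 μ θ := by
  have hfun : (fun ϑ => bandFermiRadiusDeriv μ (ϑ + π)) = bandFermiRadiusDeriv μ :=
    funext fun ϑ => bandFermiRadiusDeriv_add_pi hμ₁ hμ₂ ϑ
  have h1 : HasDerivAt (fun ϑ => bandFermiRadiusDeriv μ (ϑ + π)) (bandRadiusDeriv2 μ (θ + π)) θ :=
    (hasDerivAt_bandFermiRadiusDeriv hμ₁ hμ₂ (θ + π)).comp_add_const θ π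
  rw [hfun] at h1
  exact h1.unique (hasDerivAt_bandFermiRadiusDeriv hμ₁ hμ₂ θ)

/-- The frame flips under the half turn: `(x, y, x', y', x'', y'')(θ + π) = -(…)(θ)`. [folklore] -/
theorem frame_add_pi (θ : ℝ) :
    bandX μ (θ + π) = -bandX μ θ ∧ bandY μ (θ + π) = -bandY μ θ ∧
    bandVX μ (θ + π) = -bandVX μ θ ∧ bandVY μ (θ + π) = -bandVY μ θ ∧
    bandAX μ (θ + π) = -bandAX μ θ ∧ bandAY μ (θ + π) = -bandAY μ θ := by
  simp only [bandX, bandY, bandVX, bandVY, bandAX, bandAY, bandFermiRadius_add_pi hμ₁ hμ₂,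
    bandFermiRadiusDeriv_add_pi hμ₁ hμ₂, bandRadiusDeriv2_add_pi hμ₁ hμ₂, Real.cos_add_pi, Real.sin_add_pi]
  refine ⟨by ring, by ring, by ring, by ring, by ring, by ring⟩

/-- **The frame at `θ + jπ` is `±` the frame at `θ`.** [folklore] -/
theorem frame_add_int_mul_pi (θ : ℝ) (j : ℤ) :
    ∃ e : ℝ, (e = 1 ∨ e = -1) ∧
      bandX μ (θ + j * π) = e * bandX μ θ ∧ bandY μ (θ + j * π) = e * bandY μ θ ∧
      bandVX μ (θ + j * π) = e * bandVX μ θ ∧ bandVY μ (θ + j * π) = e * bandVY μ θ ∧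
      bandAX μ (θ + j * π) = e * bandAX μ θ ∧ bandAY μ (θ + j * π) = e * bandAY μ θ := by
  induction j using Int.induction_on with
  | zero => exact ⟨1, Or.inl rfl, by simp, by simp, by simp, by simp, by simp, by simp⟩
  | succ n ih =>
      obtain ⟨e, he, h1, h2, h3, h4, h5, h6⟩ := ih
      obtain ⟨f1, f2, f3, f4, f5, f6⟩ := frame_add_pi hμ₁ hμ₂ (θ + n * π)
      push_cast at h1 h2 h3 h4 h5 h6
      refine ⟨-e, by rcases he with h | h <;> simp [h], ?_, ?_, ?_, ?_, ?_, ?_⟩ <;>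
        push_cast <;> rw [show θ + (n + 1) * π = θ + n * π + π by ring]
      · rw [f1, h1]; ring
      · rw [f2, h2]; ring
      · rw [f3, h3]; ring
      · rw [f4, h4]; ring
      · rw [f5, h5]; ring
      · rw [f6, h6]; ring
  | pred n ih =>
      obtain ⟨e, he, h1, h2, h3, h4, h5, h6⟩ := ih
      obtain ⟨f1, f2, f3, f4, f5, f6⟩ := frame_add_pi hμ₁ hμ₂ (θ + (-(n : ℝ) - 1) * π)
      have hs : θ + (-(n : ℝ) - 1) * π + π = θ + -(n : ℝ) * π := by ring
      rw [hs] at f1 f2 f3 f4 f5 f6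
      push_cast at h1 h2 h3 h4 h5 h6
      refine ⟨-e, by rcases he with h | h <;> simp [h], ?_, ?_, ?_, ?_, ?_, ?_⟩ <;> push_cast
      · linarith
      · linarith
      · linarith
      · linarith
      · linarith
      · linarith

/-! ### The nondegeneracy -/

omit hμ₁ hμ₂ in
/-- Two plane vectors orthogonal to the same non-zero vector are parallel. [folklore] -/
theorem cross_eq_zero_of_orthogonal {a₁ a₂ b₁ b₂ v₁ v₂ : ℝ} (hv : v₁ ^ 2 + v₂ ^ 2 ≠ 0)
    (ha : a₁ * v₁ + a₂ * v₂ = 0) (hb : b₁ * v₁ + b₂ * v₂ = 0) : b₁ * a₂ - b₂ * a₁ = 0 := by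
  have e1 : (b₁ * a₂ - b₂ * a₁) * v₁ = 0 := by linear_combination (-b₂) * ha + a₂ * hb
  have e2 : (b₁ * a₂ - b₂ * a₁) * v₂ = 0 := by linear_combination b₁ * ha + (-a₁) * hb
  by_contra hne
  have hv1 : v₁ = 0 := by
    rcases mul_eq_zero.1 e1 with h | h
    · exact absurd h hne
    · exact h
  have hv2 : v₂ = 0 := by
    rcases mul_eq_zero.1 e2 with h | h
    · exact absurd h hne
    · exact h
  exact hne (by exfalso; exact hv (by rw [hv1, hv2]; ring))

/-- `x'² + y'² = u² + u'² > 0`. [folklore] -/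
theorem bandVX_sq_add_bandVY_sq_pos (θ : ℝ) : 0 < bandVX μ θ ^ 2 + bandVY μ θ ^ 2 := by
  have hu := bandFermiRadius_pos hμ₁ hμ₂ θ
  have hsc := Real.sin_sq_add_cos_sq θ
  have key : bandVX μ θ ^ 2 + bandVY μ θ ^ 2 = bandFermiRadius μ θ ^ 2 + bandFermiRadiusDeriv μ θ ^ 2 := by
    simp only [bandVX, bandVY]; nlinarith [hsc]
  rw [key]; positivity

/-- **Second-order nondegeneracy of the pair energy in the three directions `e_θ`, `e_φ`,
`e_θ + e_φ`**: for `-4 < μ < 0` and all `p, θ, φ`, the numbers `G`, `∂_θG`, `∂_φG`, `∂²_θG`,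
`∂²_φG`, `(∂_θ+∂_φ)²G` at `(θ, φ)` are not all zero. [folklore] -/
theorem pairE_nondegenerate (p : ℝ × ℝ) (θ φ : ℝ) :
    ¬(pairE μ p θ φ = 0 ∧ pairE₁ μ p θ φ = 0 ∧ pairE₂ μ p θ φ = 0 ∧
      pairE₁₁ μ p θ φ = 0 ∧ pairE₂₂ μ p θ φ = 0 ∧ pairEdd μ p θ φ = 0) := by
  rintro ⟨h0, h1, h2, h11, h22, hdd⟩
  -- `G = 0`: the pair momentum is on the level set
  have hlevel : Real.cos (pairKX μ p θ φ) + Real.cos (pairKY μ p θ φ) = -μ / 2 := by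
    simp only [pairE] at h0; linarith
  obtain ⟨ψ, hcX, hsX, hcY, hsY⟩ := exists_angle_of_level hμ₁ hμ₂ hlevel
  -- `∂_θG = 0` and `∂_φG = 0`: the gradients at `P` and at `γ(θ)`, `γ(φ)` are parallel
  have hTθ := sin_mul_bandVX_add hμ₁ hμ₂ θ
  have hTφ := sin_mul_bandVX_add hμ₁ hμ₂ φ
  have h1' : Real.sin (bandX μ ψ) * bandVX μ θ + Real.sin (bandY μ ψ) * bandVY μ θ = 0 := by
    simp only [pairE₁] at h1; rw [hsX, hsY]; linarith
  have h2' : Real.sin (bandX μ ψ) * bandVX μ φ + Real.sin (bandY μ ψ) * bandVY μ φ = 0 := by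
    simp only [pairE₂] at h2; rw [hsX, hsY]; linarith
  have hcrossθ : Real.sin (bandX μ θ) * Real.sin (bandY μ ψ) - Real.sin (bandY μ θ) * Real.sin (bandX μ ψ) = 0 :=
    cross_eq_zero_of_orthogonal (bandVX_sq_add_bandVY_sq_pos hμ₁ hμ₂ θ).ne' h1' hTθ
  have hcrossφ : Real.sin (bandX μ φ) * Real.sin (bandY μ ψ) - Real.sin (bandY μ φ) * Real.sin (bandX μ ψ) = 0 :=
    cross_eq_zero_of_orthogonal (bandVX_sq_add_bandVY_sq_pos hμ₁ hμ₂ φ).ne' h2' hTφ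
  obtain ⟨j₁, hj₁⟩ := exists_eq_add_int_mul_pi_of_cross_eq_zero hμ₁ hμ₂ hcrossθ
  obtain ⟨j₂, hj₂⟩ := exists_eq_add_int_mul_pi_of_cross_eq_zero hμ₁ hμ₂ hcrossφ
  -- `θ = ψ + (-j₁)π`, `φ = ψ + (-j₂)π`
  have hθ : θ = ψ + (-j₁ : ℤ) * π := by push_cast; linarith
  have hφ : φ = ψ + (-j₂ : ℤ) * π := by push_cast; linarith
  obtain ⟨e₁, he₁, -, -, hvx₁, hvy₁, hax₁, hay₁⟩ := frame_add_int_mul_pi hμ₁ hμ₂ ψ (-j₁)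
  obtain ⟨e₂, he₂, -, -, hvx₂, hvy₂, hax₂, hay₂⟩ := frame_add_int_mul_pi hμ₁ hμ₂ ψ (-j₂)
  rw [← hθ] at hvx₁ hvy₁ hax₁ hay₁
  rw [← hφ] at hvx₂ hvy₂ hax₂ hay₂
  -- curvature data at `ψ`
  have hQ := bandHess_pos hμ₁ hμ₂ ψ
  have hT := bandHess_add_grad_dot_acc hμ₁ hμ₂ ψ
  have hsq₁ : e₁ ^ 2 = 1 := by rcases he₁ with h | h <;> simp [h]
  have hsq₂ : e₂ ^ 2 = 1 := by rcases he₂ with h | h <;> simp [h]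
  -- the three second derivatives in terms of `Q = cos x·x'² + cos y·y'²`, `e₁`, `e₂`
  have e11 : pairE₁₁ μ p θ φ =
      2 * (Real.cos (bandX μ ψ) * bandVX μ ψ ^ 2 + Real.cos (bandY μ ψ) * bandVY μ ψ ^ 2) * (1 - e₁) := by
    unfold pairE₁₁
    rw [← hcX, ← hsX, ← hcY, ← hsY, hvx₁, hvy₁, hax₁, hay₁]
    linear_combination (2 * e₁) * hT +
      (2 * (Real.cos (bandX μ ψ) * bandVX μ ψ ^ 2 + Real.cos (bandY μ ψ) * bandVY μ ψ ^ 2)) * hsq₁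
  have e22 : pairE₂₂ μ p θ φ =
      2 * (Real.cos (bandX μ ψ) * bandVX μ ψ ^ 2 + Real.cos (bandY μ ψ) * bandVY μ ψ ^ 2) * (1 - e₂) := by
    unfold pairE₂₂
    rw [← hcX, ← hsX, ← hcY, ← hsY, hvx₂, hvy₂, hax₂, hay₂]
    linear_combination (2 * e₂) * hT +
      (2 * (Real.cos (bandX μ ψ) * bandVX μ ψ ^ 2 + Real.cos (bandY μ ψ) * bandVY μ ψ ^ 2)) * hsq₂
  have e12 : pairE₁₂ μ p θ φ =
      2 * (Real.cos (bandX μ ψ) * bandVX μ ψ ^ 2 + Real.cos (bandY μ ψ) * bandVY μ ψ ^ 2) * (e₁ * e₂) := by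
    unfold pairE₁₂
    rw [← hcX, ← hcY, hvx₁, hvy₁, hvx₂, hvy₂]
    ring
  have hE₁ : e₁ = 1 := by
    rcases he₁ with h | h
    · exact h
    · exfalso
      rw [e11, h] at h11
      have h4 : 2 * (Real.cos (bandX μ ψ) * bandVX μ ψ ^ 2 + Real.cos (bandY μ ψ) * bandVY μ ψ ^ 2) * (1 - (-1 : ℝ)) =
          4 * (Real.cos (bandX μ ψ) * bandVX μ ψ ^ 2 + Real.cos (bandY μ ψ) * bandVY μ ψ ^ 2) := by ring
      rw [h4] at h11
      linarith
  have hE₂ : e₂ = 1 := by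
    rcases he₂ with h | h
    · exact h
    · exfalso
      rw [e22, h] at h22
      have h4 : 2 * (Real.cos (bandX μ ψ) * bandVX μ ψ ^ 2 + Real.cos (bandY μ ψ) * bandVY μ ψ ^ 2) * (1 - (-1 : ℝ)) =
          4 * (Real.cos (bandX μ ψ) * bandVX μ ψ ^ 2 + Real.cos (bandY μ ψ) * bandVY μ ψ ^ 2) := by ring
      rw [h4] at h22
      linarith
  have : pairEdd μ p θ φ = 4 * (Real.cos (bandX μ ψ) * bandVX μ ψ ^ 2 + Real.cos (bandY μ ψ) * bandVY μ ψ ^ 2) := by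
    rw [pairEdd, e11, e12, e22, hE₁, hE₂]; ring
  rw [this] at hdd
  linarith

end Band

end Literature.MathematicalPhysics.QuantumLattice

end
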